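import Summits.CriticalPhenomena.PercolationContinuityZ3.Theorems.Transplant.AutCocompactAnyStabilizers
import HarnessLib

/-!
# A FAITHFUL cocompact action of a TORSION-FREE NILPOTENT group by automorphisms of a connected locally finite graph is FREE — hence clause (ii)
# of the lane's C2 words for such actions with NO stabiliser / finite-generation hypothesis

builds on p205010 (kernel theorem, internal audit signed; external expert review pending).  Lane `prim-bschramm`, seat `prim-bschramm-stmt`
gen 38 (stmt port pen; lead g25 GO #7697, parts (C)(D); parts (A)(B) = «AutCocompactAnyStabilizers»).  Helper file
(`--supports stmt-CriticalPhenomena-4575 --as helper`); PROOFS ONLY (def-free, no `instance`, no notation); NOT by-name — no `@[conjecture]` node is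
touched or settled, STATEMENTS §5 counts unchanged; nothing about growth beyond what p563737 / p561153 already carry; nothing about
`BenjaminiSchramm1996_conj4_endState`; no 'closed' wording — the words are the lead's.

THE THEOREM (`stabilizer_eq_bot_of_torsionFree_nilpotent`, `free_of_torsionFree_nilpotent`).  `A` nilpotent WITHOUT non-trivial elements of
finite order, acting by automorphisms on a connected locally finite graph `X` with finitely many orbits and FAITHFULLY — 'faithful' meaning
exactly: the kernel of `A → Perm W` is trivial, `(∀ v, a • v = v) → a = 1` — ⟹ every vertex stabiliser is TRIVIAL (the action is free).
PROOF (induction on the upper central series, claim `Z_n ∩ Stab(w) = ⊥` for all `w`; `Z_0 = ⊥`; at the top `Z_c = A`): let `s ∈ Z_{n+1}` fix `w`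
and let `g ∈ A`.  By the commensurability lemma of «AutCocompactAnyStabilizers» §1 (`exists_pos_pow_smul_eq` — THIS is where 'connected' and
'locally finite' enter: the `Stab(w)`-translates of `g • w` lie in a finite ball) some `s ^ k`, `k ≥ 1`, fixes `g • w`; the commutator
`⁅s ^ k, g⁆ = s^k g s^{-k} g^{-1}` lies in `Z_n` (`Subgroup.mem_upperCentralSeries_succ_iff`) and fixes `g • w`, so it is `1` by induction: `g`
commutes with `s ^ k`.  With the FINITE section set `S` of the cocompact action (`exists_finset_closure_smul_reps`: `closure S • reps = W`) the
uniform power `s ^ K`, `K = ∏_{g ∈ S} k_g ≥ 1`, is centralised by `closure S`; a further power `(s ^ K) ^ M`, `M = ∏_{r ∈ reps} m_r ≥ 1`, fixes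
every representative (commensurability again), hence every vertex `a • r`, `a ∈ closure S`; so `(s ^ K) ^ M = 1` (faithful) and `s = 1` —
torsion-freeness is used exactly ONCE, here.  `A` is NOT assumed finitely generated and `W` is NOT assumed infinite (for finite `W` a faithful
torsion-free `A` is trivial and the statement is empty-true).  COROLLARIES: `conj4_of_torsionFree_nilpotent_faithful` — `p_c < 1 ⟹ θ_x(p_c) = 0`
for such actions (free ⟹ finite stabilisers ⟹ gen-5 g3's `conj4_of_nilpotent_of_stabilizers_finite` p563737; equally gen-1 g6's free form
p561153) — and the finite-index form `conj4_of_virtuallyTorsionFreeNilpotent_faithful` (`A` faithful with a finite-index nilpotent subgroup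
without non-trivial finite-order elements; restrict — the subgroup acts faithfully, hence freely).  NOT COVERED: non-faithful nilpotent actions
whose faithful quotient has torsion and no abelian finite-index subgroup exhibited.

PRESEARCH (stmt-g38, 2026-08-28, verbatim as asked): 'torsion-free nilpotent + faithful + cocompact on a connected locally finite graph ⟹ free' —
NOT FOUND as a stated lemma (queries: corpus hybrid "nilpotent group automorphisms locally finite graph finitely many orbits vertex stabilizers
finite torsion-free acts freely" → 8 unrelated book hits; galaxy all-stars "bounded automorphisms|commensurable stabilizers|stabilizers are
commensurable|vertex stabilisers are finite" → Imrich, Rogla 2018 lecture 'vertex-transitivity … graphs of polynomial growth' (Trofimov's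
imprimitivity theorem, background) and noise); nearest in print: Trofimov 1985 (automorphism groups of graphs of polynomial growth act with
finite stabilisers on a finite-block quotient) and Woess 2000 §1 / Lemma 3.13 — both about the quotient, neither gives freeness of a GIVEN
torsion-free nilpotent group; the commensurability step is [folklore].
[cite: BenjaminiSchramm1996, §2 (almost transitive graphs), Conj. 4] [cite: Woess2000, Prop. 3.9, Lemma 3.13]
[cite: Trofimov1985, Thm. 2 (background only, not used)] [cite: WolfGrowth1968, Thm. 3.2 (inside p563737)] [cite: LyonsPeres2016, §7.4]
-/

noncomputable section

namespace Summit.CriticalPhenomena.PercolationContinuityZ3.Theorems.Transplant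

namespace AutCyl

open SimpleGraph Literature.Barriers.CriticalPhenomena Literature.Probability.LatticeModels Literature.Probability.Percolation
open scoped Classical commutatorElement

variable {W : Type} {X : SimpleGraph W} {A : Type} [Group A] [MulAction A W]

/-! ## §4 TORSION-FREE NILPOTENT groups acting FAITHFULLY: the action is free -/

section TorsionFree

variable [X.LocallyFinite]

/-- **A FAITHFUL action with finitely many orbits by automorphisms of a TORSION-FREE NILPOTENT group on a connected locally finite graph is FREE**:
every vertex stabiliser is trivial.  'Torsion-free' = no non-trivial element of finite order (`htf`); 'faithful' = trivial kernel of `A → Perm W`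
(`hfaith : (∀ v, a • v = v) → a = 1`).  Induction on the upper central series: for `s ∈ Z_{n+1}` fixing `w` and any `g`, some `s ^ k` fixes `g • w` (§1)
and `⁅s ^ k, g⁆ ∈ Z_n` fixes `g • w`, so `⁅s ^ k, g⁆ = 1` by induction; a uniform power `s ^ K` then commutes with the finitely generated subgroup of
`exists_finset_closure_smul_reps`, a further power fixes every representative, hence every vertex, hence is `1` (faithful), and `s = 1` (torsion-free).
No finite-generation hypothesis on `A`. [folklore] [cite: Woess2000, Prop. 3.9, Lemma 3.13] -/
theorem stabilizer_eq_bot_of_torsionFree_nilpotent [Group.IsNilpotent A] (htf : ∀ a : A, IsOfFinOrder a → a = 1)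
    (hfaith : ∀ a : A, (∀ v : W, a • v = v) → a = 1) (hact : IsActionByAut X A) (hc : X.Connected) (reps : Finset W)
    (hcover : ∀ w : W, ∃ a : A, ∃ r ∈ reps, a • r = w) (w : W) : MulAction.stabilizer A w = ⊥ := by
  obtain ⟨S, hS⟩ := exists_finset_closure_smul_reps hact hc reps hcover
  have key : ∀ (n : ℕ) (w : W) (s : A), s • w = w → s ∈ Subgroup.upperCentralSeries A n → s = 1 := by
    intro n
    induction n with
    | zero =>
      intro w s _ hs
      rwa [Subgroup.upperCentralSeries_zero, Subgroup.mem_bot] at hs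
    | succ n ih =>
      intro w s hsw hs
      -- Step 1: every `g` commutes with some positive power of `s`
      have hcommute : ∀ g : A, ∃ k : ℕ, 0 < k ∧ Commute g (s ^ k) := fun g => by
        obtain ⟨k, hk, hfix⟩ := exists_pos_pow_smul_eq hact hc hsw (g • w)
        refine ⟨k, hk, ?_⟩
        have hu : ⁅s ^ k, g⁆ ∈ Subgroup.upperCentralSeries A n :=
          (Subgroup.mem_upperCentralSeries_succ_iff.1 (Subgroup.pow_mem _ hs k)) g
        have hskw : (s ^ k)⁻¹ • w = w := inv_smul_eq_iff.2 (pow_smul_eq_of_smul_eq hsw k).symm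
        have hufix : ⁅s ^ k, g⁆ • (g • w) = g • w := by
          rw [commutatorElement_def, mul_smul, mul_smul, mul_smul, inv_smul_smul, hskw, hfix]
        have h1 : ⁅s ^ k, g⁆ = 1 := ih (g • w) _ hufix hu
        exact (commutatorElement_eq_one_iff_mul_comm.1 h1).symm
      choose k hk hkc using hcommute
      -- Step 2: a uniform power central on `closure S`
      set K : ℕ := ∏ g ∈ S, k g with hK
      have hKpos : 0 < K := Finset.prod_pos fun g _ => hk g
      have hcen : Subgroup.closure (S : Set A) ≤ Subgroup.centralizer {s ^ K} := by
        rw [Subgroup.closure_le]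
        intro g hgS
        rw [SetLike.mem_coe, Subgroup.mem_centralizer_iff]
        intro h hh
        rw [Set.mem_singleton_iff] at hh
        subst hh
        obtain ⟨m, hm⟩ := Finset.dvd_prod_of_mem k (Finset.mem_coe.1 hgS)
        rw [hK, hm, pow_mul]
        exact ((hkc g).pow_right m).symm.eq
      -- Step 3: a further power fixing every representative, hence every vertex
      have hsKw : (s ^ K) • w = w := pow_smul_eq_of_smul_eq hsw K
      have hfixr : ∀ r : W, ∃ m : ℕ, 0 < m ∧ (s ^ K) ^ m • r = r := fun r => exists_pos_pow_smul_eq hact hc hsKw r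
      choose m hm hmfix using hfixr
      set M : ℕ := ∏ r ∈ reps, m r with hM
      have hMpos : 0 < M := Finset.prod_pos fun r _ => hm r
      have hfixall : ∀ v : W, (s ^ K) ^ M • v = v := fun v => by
        obtain ⟨a, ha, r, hr, rfl⟩ := hS v
        obtain ⟨q, hq⟩ := Finset.dvd_prod_of_mem m hr
        have hc1 : Commute (s ^ K) a :=
          Subgroup.mem_centralizer_iff.1 (hcen ha) (s ^ K) (Set.mem_singleton _)
        calc (s ^ K) ^ M • a • r = ((s ^ K) ^ M * a) • r := by rw [mul_smul]
          _ = (a * (s ^ K) ^ M) • r := by rw [(hc1.pow_left M).eq]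
          _ = a • ((s ^ K) ^ M • r) := by rw [mul_smul]
          _ = a • r := by rw [hM, hq, pow_mul, pow_smul_eq_of_smul_eq (hmfix r) q]
      -- Step 4: faithful and torsion-free
      have hone : (s ^ K) ^ M = 1 := hfaith _ hfixall
      exact htf s (isOfFinOrder_iff_pow_eq_one.2 ⟨K * M, Nat.mul_pos hKpos hMpos, by rw [pow_mul, hone]⟩)
  obtain ⟨n, hn⟩ := Group.IsNilpotent.nilpotent A
  refine (Subgroup.eq_bot_iff_forall _).2 fun s hs => key n w s (MulAction.mem_stabilizer_iff.1 hs) ?_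
  rw [hn]
  exact Subgroup.mem_top s

/-- The free form: under the hypotheses of `stabilizer_eq_bot_of_torsionFree_nilpotent`, `a • w = w ⟹ a = 1`. [folklore] -/
theorem free_of_torsionFree_nilpotent [Group.IsNilpotent A] (htf : ∀ a : A, IsOfFinOrder a → a = 1)
    (hfaith : ∀ a : A, (∀ v : W, a • v = v) → a = 1) (hact : IsActionByAut X A) (hc : X.Connected) (reps : Finset W)
    (hcover : ∀ w : W, ∃ a : A, ∃ r ∈ reps, a • r = w) : ∀ (a : A) (w : W), a • w = w → a = 1 := fun a w h => by
  have hmem : a ∈ MulAction.stabilizer A w := MulAction.mem_stabilizer_iff.2 h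
  rwa [stabilizer_eq_bot_of_torsionFree_nilpotent htf hfaith hact hc reps hcover w, Subgroup.mem_bot] at hmem

/-- **Φ2 / CONJECTURE 4 FOR FAITHFUL COCOMPACT ACTIONS OF TORSION-FREE NILPOTENT GROUPS — NO stabiliser or finite-generation hypothesis.**
A torsion-free nilpotent group acting faithfully by automorphisms with finitely many orbits on a connected locally finite graph with `p_c < 1`:
`θ_x(p_c) = 0` at every vertex (the action is free by `stabilizer_eq_bot_of_torsionFree_nilpotent`; then gen-5 g3's finite-stabiliser theorem).
[cite: BenjaminiSchramm1996, Conj. 4; §2 (almost transitive graphs)] [cite: WolfGrowth1968, Thm. 3.2] -/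
theorem conj4_of_torsionFree_nilpotent_faithful [Group.IsNilpotent A] (htf : ∀ a : A, IsOfFinOrder a → a = 1)
    (hfaith : ∀ a : A, (∀ v : W, a • v = v) → a = 1) (hc : X.Connected) (hact : IsActionByAut X A) (reps : Finset W)
    (hcover : ∀ w : W, ∃ a : A, ∃ r ∈ reps, a • r = w) (x : W) (hpc : criticalProb X x < 1) :
    theta X x (criticalProbIOf X x) = 0 :=
  conj4_of_nilpotent_of_stabilizers_finite X hc A hact
    (fun w => by
      rw [stabilizer_eq_bot_of_torsionFree_nilpotent htf hfaith hact hc reps hcover w, Subgroup.coe_bot]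
      exact Set.finite_singleton 1)
    reps hcover x hpc

/-- **Finite-index form**: `A` acts FAITHFULLY by automorphisms with finitely many orbits on a connected locally finite graph with `p_c < 1` and has a
finite-index NILPOTENT subgroup `N` without non-trivial elements of finite order ⟹ `θ_x(p_c) = 0` at every vertex (restrict to `N`, which acts
faithfully and, by §4, freely). [cite: BenjaminiSchramm1996, Conj. 4; §2 (almost transitive graphs)] [cite: LyonsPeres2016, §7.4 (quasi-transitive actions)] -/
theorem conj4_of_virtuallyTorsionFreeNilpotent_faithful (hc : X.Connected) (hact : IsActionByAut X A) (reps : Finset W)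
    (hcover : ∀ w : W, ∃ a : A, ∃ r ∈ reps, a • r = w) (hfaith : ∀ a : A, (∀ v : W, a • v = v) → a = 1)
    (N : Subgroup A) [N.FiniteIndex] [Group.IsNilpotent N] (htf : ∀ a ∈ N, IsOfFinOrder a → a = 1)
    (x : W) (hpc : criticalProb X x < 1) : theta X x (criticalProbIOf X x) = 0 := by
  obtain ⟨reps', hcover'⟩ := exists_reps_of_finiteIndex N reps hcover
  refine conj4_of_torsionFree_nilpotent_faithful (A := N) (fun a ha => Subtype.ext ?_) (fun a h => Subtype.ext (hfaith a fun v => ?_))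
    hc (isActionByAut_subgroup hact N) reps' hcover' x hpc
  · obtain ⟨n, hn, han⟩ := isOfFinOrder_iff_pow_eq_one.1 ha
    exact htf a a.2 (isOfFinOrder_iff_pow_eq_one.2 ⟨n, hn, by rw [← Subgroup.coe_pow, han, Subgroup.coe_one]⟩)
  · have hv := h v
    rwa [Subgroup.smul_def] at hv

end TorsionFree

end AutCyl

end Summit.CriticalPhenomena.PercolationContinuityZ3.Theorems.Transplant

end
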